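import Literature.Probability.RandomPlanarGeometry.SAWZdLateralClassCensus
import Literature.Probability.RandomPlanarGeometry.SAWPulledFreeEnergyZ2
import HarnessLib

/-!
# Bridges of given span and Beaton's pulled partition function `Z^B_N(y)` on `ℤ^{d+1}`: the coefficients `β_{N,A}(ℤ^{d+1})` are INTEGER POLYNOMIALS IN `2d`
# (hyperoctahedral normal form, dimension congruences) — so `Z^B_N(y) ∈ ℤ[2d][y]`

Topic `Literature/Probability/RandomPlanarGeometry` (continues `SAWZdLateralClassCensus.lean`: the generic lateral axis-class census `card_filter_saws_eq_sum_classes_mul_descFactorial`,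
`exists_int_polynomial_card_filter_saws`, `dvd_sub_card_filter_saws`; uses `SAWBridgeDivergence.brSpan` (`β_{N,A}`: bridges of length `N` and span `A`) and
`SAWPulledFreeEnergyZ2.pulledBridgeZ` (`Z^B_N(y) = Σ_A β_{N,A} y^A`), `isBridge_extend_iff`, `isBridge_congr_zero`).

PRINTED CONTEXT (locators only). Beaton (2015) §2 (`B(x,y)`, pulled bridges), §3 Lemma 1; Madras–Slade (1993) Definition 3.1.3 (span), §1.1 eq. (1.1.8); Graham (2010) §4.
NOT IN PRINT (lane statements): the class «bridge of span `A`» is transported by the lateral zero-extensions and invariant under the signed relabellings of the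
lateral axes (both read off the force coordinate), so the generic census applies:

* ★★★ `card_brSpan_eq_sum_classes_mul_descFactorial` — **`β_{N,A}(ℤ^{d+1}) = Σ_{u ≤ N} G_{N,A}(u)·2^u·d(d−1)⋯(d−u+1)`** for every `d`;
* ★★★ `exists_int_polynomial_card_brSpan` — **`β_{N,A}(ℤ^{d+1}) = Q_{N,A}(2d)`, `Q_{N,A} ∈ ℤ[X]`, `deg ≤ N`, `Q_{N,A}(0) = β_{N,A}(ℤ¹)`**;
* ★★ `dvd_sub_card_brSpan` — `4dd′(d−d′) ∣ d′(β_{N,A}(ℤ^{d+1}) − β_{N,A}(ℤ¹)) − d(β_{N,A}(ℤ^{d′+1}) − β_{N,A}(ℤ¹))`;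
* ★★★ `exists_int_polynomials_pulledBridgeZ` — **`Z^B_N(y) = Σ_{A ≤ N} Q_{N,A}(2d)·y^A` on `ℤ^{d+1}` for every `d`, `y`**: Beaton's finite-`N` pulled partition functions have
  coefficients in `ℤ[2d]` — the finite-`N` shadow of this lineage's `c_k^{(d)} ∈ 2d·ℤ[2d]` for the large-force expansion of `λ_B(y)`.
[cite: Beaton2015, §2 (B(x,y)); §3 Lemma 1] [cite: MadrasSlade1993, Definition 3.1.3; §1.1 eq. (1.1.8) p. 5] [cite: Graham2010, Section 4]

Provenance: lane «pcv-sawmu», a-p3 g25 (2026-08-28). PURE STD, no data, no definitions.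
-/

noncomputable section

open Finset
open scoped BigOperators
open Literature.Probability.LatticeModels
open Literature.Probability.RandomPlanarGeometry.SAW

namespace Literature.Probability.RandomPlanarGeometry.SAW.Zd

/-- The zero-extension along a lateral injection preserves the force coordinate. [folklore] -/
private theorem gext_apply_zero' {u d : ℕ} {e : Fin (u + 1) → Fin (d + 1)} (he : Function.Injective e) (he0 : e 0 = 0)
    (x : Site (u + 1)) : Function.extend e x (0 : Fin (d + 1) → ℤ) 0 = x 0 := by
  rw [← he0, he.extend_apply]

/-! ## §14 Bridges by span and Beaton's pulled partition function `Z^B_N(y)` on `ℤ^{d+1}`: coefficients in `ℤ[2d]` -/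

section Span

/-- `brSpan` as a filter of the self-avoiding walks. [cite: MadrasSlade1993, Definition 3.1.3] -/
private theorem brSpan_eq_filter_saws (D N : ℕ) (A : ℤ) :
    open Classical in
    brSpan (D + 1) N A = (saws (D + 1) N).filter fun (Ω : ℕ → Site (D + 1)) => IsBridge N Ω ∧ Ω N 0 = A := by
  ext ω
  simp only [brSpan, bridges, Finset.mem_filter, and_assoc]

/-- The span class is transported by the lateral zero-extensions. [cite: MadrasSlade1993, Definition 3.1.3] -/
private theorem span_extend_iff (N : ℕ) (A : ℤ) {u d : ℕ} {e : Fin (u + 1) → Fin (d + 1)} (he : Function.Injective e) (he0 : e 0 = 0)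
    (ω : ℕ → Site (u + 1)) :
    (IsBridge N (fun i => Function.extend e (ω i) (0 : Fin (d + 1) → ℤ)) ∧ (fun i => Function.extend e (ω i) (0 : Fin (d + 1) → ℤ)) N 0 = A) ↔
      (IsBridge N ω ∧ ω N 0 = A) := by
  rw [isBridge_extend_iff he he0 ω]
  simp only [gext_apply_zero' he he0]

/-- The span class is invariant under the signed relabellings of the lateral axes. [cite: MadrasSlade1993, Definition 3.1.3] -/
private theorem span_latRelabel_iff (N : ℕ) (A : ℤ) (u : ℕ) (g : Equiv.Perm (Fin u) × (Fin u → Bool)) (ω : ℕ → Site (u + 1)) :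
    (IsBridge N (fun i => latRelabel u g (ω i)) ∧ (fun i => latRelabel u g (ω i)) N 0 = A) ↔ (IsBridge N ω ∧ ω N 0 = A) := by
  rw [isBridge_congr_zero (ω := fun i => latRelabel u g (ω i)) (ω' := ω) fun i => latRelabel_apply_zero g (ω i)]
  simp only [latRelabel_apply_zero]

/-- ★★★ **BRIDGES OF GIVEN SPAN, NORMAL FORM**: for every `N`, `A` and EVERY `d`, `β_{N,A}(ℤ^{d+1}) = #brSpan = Σ_{u ≤ N} G_{N,A}(u) · 2^u · d(d−1)⋯(d−u+1)`,
`G_{N,A}(u) ∈ ℕ` the number of hyperoctahedral classes of `N`-step bridges of span `A` of `ℤ^{u+1}` using every lateral axis. [cite: Beaton2015, §2 (B(x,y))]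
[cite: MadrasSlade1993, Definition 3.1.3; §1.1 eq. (1.1.8) p. 5] [cite: Graham2010, Section 4] -/
theorem card_brSpan_eq_sum_classes_mul_descFactorial (d N : ℕ) (A : ℤ) :
    open Classical in
    (brSpan (d + 1) N A).card = ∑ u ∈ Finset.range (N + 1),
      ((saws (u + 1) N).filter fun (ω : ℕ → Site (u + 1)) => (IsBridge N ω ∧ ω N 0 = A) ∧
        ∀ a : Fin (u + 1), a ≠ 0 → ∃ i ≤ N, ω i a ≠ (0 : ℤ)).card / (2 ^ u * u.factorial) * (2 ^ u * d.descFactorial u) := by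
  rw [brSpan_eq_filter_saws]
  convert card_filter_saws_eq_sum_classes_mul_descFactorial (n := N) (fun D Ω => IsBridge N Ω ∧ Ω N 0 = A)
    (fun he he0 ω => span_extend_iff N A he he0 ω) (fun u g ω _ => span_latRelabel_iff N A u g ω) d

/-- ★★★ **`β_{N,A}(ℤ^{d+1})` IS AN INTEGER POLYNOMIAL IN `2d`**: there is `Q ∈ ℤ[X]`, `deg ≤ N`, `Q(0) = β_{N,A}(ℤ¹)`, with `β_{N,A}(ℤ^{d+1}) = Q(2d)` for every `d`.
[cite: Beaton2015, §2 (B(x,y))] [cite: Graham2010, Section 4] -/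
theorem exists_int_polynomial_card_brSpan (N : ℕ) (A : ℤ) :
    ∃ Q : Polynomial ℤ, Q.natDegree ≤ N ∧ Q.coeff 0 = ((brSpan 1 N A).card : ℤ) ∧
      ∀ d : ℕ, ((brSpan (d + 1) N A).card : ℤ) = Q.eval (2 * (d : ℤ)) := by
  obtain ⟨Q, hQ, hQ0, hev⟩ := exists_int_polynomial_card_filter_saws (n := N) (fun D Ω => IsBridge N Ω ∧ Ω N 0 = A)
    (fun he he0 ω => span_extend_iff N A he he0 ω) (fun u g ω _ => span_latRelabel_iff N A u g ω)
  refine ⟨Q, hQ, ?_, fun d => ?_⟩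
  · rw [hQ0, brSpan_eq_filter_saws 0 N A]
    congr
  · rw [← hev d, brSpan_eq_filter_saws d N A]
    congr

/-- ★★ **THE DIMENSION CONGRUENCE FOR BRIDGES OF GIVEN SPAN**: `4·d·d′·(d − d′) ∣ d′(β_{N,A}(ℤ^{d+1}) − β_{N,A}(ℤ¹)) − d(β_{N,A}(ℤ^{d′+1}) − β_{N,A}(ℤ¹))`.
[cite: Beaton2015, §2 (B(x,y))] [cite: Graham2010, Section 4] -/
theorem dvd_sub_card_brSpan (N : ℕ) (A : ℤ) (d d' : ℕ) :
    (4 * (d : ℤ) * d' * ((d : ℤ) - d')) ∣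
      (d' : ℤ) * (((brSpan (d + 1) N A).card : ℤ) - (brSpan 1 N A).card) -
        (d : ℤ) * (((brSpan (d' + 1) N A).card : ℤ) - (brSpan 1 N A).card) := by
  have h := dvd_sub_card_filter_saws (n := N) (fun D Ω => IsBridge N Ω ∧ Ω N 0 = A)
    (fun he he0 ω => span_extend_iff N A he he0 ω) (fun u g ω _ => span_latRelabel_iff N A u g ω) d d'
  rw [brSpan_eq_filter_saws d N A, brSpan_eq_filter_saws d' N A, brSpan_eq_filter_saws 0 N A]
  convert h

/-- ★★★ **BEATON'S PULLED PARTITION FUNCTION HAS COEFFICIENTS IN `ℤ[2d]`**: for every `N` there are `Q_{N,0}, …, Q_{N,N} ∈ ℤ[X]` (`deg ≤ N`) with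
`Z^B_N(y) = Σ_{A=0}^{N} Q_{N,A}(2d) · y^A` on `ℤ^{d+1}` for EVERY `d` and every `y` — the pulled problem's finite-`N` data are integer polynomials in the number
of lateral directions. [cite: Beaton2015, §2 (B(x,y)); §3 Lemma 1] [cite: Graham2010, Section 4] -/
theorem exists_int_polynomials_pulledBridgeZ (N : ℕ) :
    ∃ Q : ℕ → Polynomial ℤ, (∀ A, (Q A).natDegree ≤ N) ∧
      ∀ (d : ℕ) (y : ℝ), pulledBridgeZ (d + 1) N y = ∑ A ∈ Finset.range (N + 1), (((Q A).eval (2 * (d : ℤ)) : ℤ) : ℝ) * y ^ A := by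
  choose Q hQ using fun A : ℕ => exists_int_polynomial_card_brSpan N (A : ℤ)
  refine ⟨Q, fun A => (hQ A).1, fun d y => ?_⟩
  unfold pulledBridgeZ
  refine Finset.sum_congr rfl fun A _ => ?_
  rw [← (hQ A).2.2 d]
  push_cast
  rfl

end Span

end Literature.Probability.RandomPlanarGeometry.SAW.Zd

end
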